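import Literature.NumberTheory.Sieve.QuadraticRootsTothColumn
import Literature.NumberTheory.Sieve.FriedlanderIwaniecPrimesPoisson
import Mathlib.Logic.Equiv.Fin.Basic
import HarnessLib

/-!
# The Tóth sums through the column function: Poisson summation and the dual form

Topic `Literature/NumberTheory/Sieve`.  The hypothesis `HP` of
`…TothReduction.toth2000_quadraticRoots_primeModuli_of_tothPoincareBound` bounds the Tóth sums
`T = ∑'_{v ∈ PrimVec a} W_R(ξ_v) ψ_R(ξ_v)` (`W_R = weylWeightSL`, `ψ_R = tothWeight`).  This file
rewrites each term through the real column function `colFn` of `QuadraticRootsTothColumn.lean`: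
for a matrix `ξ` with first column `(α, γ)`, `α ≠ 0`,

  `W_R(ξ) ψ_R(ξ) = [ad ∣ A'(α,γ)] · e(hβ/α) · colFn(α, γ)`,   `β = ξ₀₁ ≡ −γ̄ (mod α)`

(`weylWeightSL_mul_tothWeight_eq`: the range condition `0 < A' ≤ a⌈3x⌉` of `weylWeight` is
automatic on the support of the plateau, Hooley's identity `weylPhase_factor` splits the phase,
`colA_col`/`colPsi_col`/`colPhi_col` identify the factors), and packages the arithmetic
coefficient of the column `α`,

  `colCoef(α, γ) = [(α,γ) = 1] [a ∣ γ] [ad ∣ A'(α,γ)] e(−h·gcdB(α,γ)/α)`,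

which is periodic in `γ` with period `M_α = |α|·a·d` (`colCoef_add_period`).  Then the Poisson
step of Tóth's method (T. Ngo, arXiv:2107.13301, §3.5 Lemma 3.15) in the first-column conventions
of this tree: the Tóth sum is a finite double sum over a box (`tothSum_eq_boxSum`; for Tóth's shift
`m = tothShift` the column `α = 0` drops, `boxSum_col_zero_eq_zero`), each column `α ≠ 0` is
summed over residue classes mod `M_α` and Poisson summation is applied in each class
(`colSum_eq_poisson`, from the tree's `FriedlanderIwaniecPrimes.tsum_arithProg_eq_tsum_fourier`),
and the `r`-sums assemble into the complete exponential sums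
`S_α(h, κ) = ∑_{r mod M_α} colCoef(α, r) e(rκ/M_α)` (`colExpSum`: Kloosterman-type sums to
modulus `α` twisted by the level condition), giving the **dual form**

  `T = ∑_{0 < |α| ≤ A} M_α⁻¹ ∑_{κ ∈ ℤ} 𝓕(colFn(α,·))(κ/M_α) · S_α(h, κ)`   (`tothSum_eq_dualSum`),

absolutely convergent by the decay of the Fourier transforms.  The analytic input of `HP`
(`…TothReduction`) is a bound for exactly these sums of Kloosterman-type sums (Ngo, Theorem 2.5).

## References

* T. Ngo, *On roots of quadratic congruences*, arXiv:2107.13301, §3.2 Lemma 3.2, §3.5 Lemma 3.15.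
  [cite: Ngo2024, §3.5 Lemma 3.15]
* Á. Tóth, *Roots of quadratic congruences*, IMRN 2000, 719–739. [cite: Toth2000, §4]
-/

noncomputable section

namespace Literature.NumberTheory.Sieve

open scoped MatrixGroups
open Literature.NumberTheory.QuadraticFields.Quadratic (BinQF)

namespace RootForms

variable {R : BinQF}

/-! ### The index of a level form as a real number -/

/-- For `a > 0`, `a ∣ A'`, `A' > 0`: `index a Q = A'/a` in `ℝ`. [folklore] -/
theorem index_cast_eq {a : ℤ} (ha : 0 < a) {Q : BinQF} (hdvd : a ∣ Q.a) (hpos : 0 < Q.a) :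
    ((index a Q : ℕ) : ℝ) = (Q.a : ℝ) / a := by
  obtain ⟨k, hk⟩ := hdvd
  have hk0 : 0 < k := (mul_pos_iff_of_pos_left ha).1 (by rw [← hk]; exact hpos)
  have ha0 : (a : ℝ) ≠ 0 := by exact_mod_cast ha.ne'
  rw [index, hk, Int.mul_ediv_cancel_left _ ha.ne']
  have e : ((k.toNat : ℕ) : ℤ) = k := Int.toNat_of_nonneg hk0.le
  have e' : ((k.toNat : ℕ) : ℝ) = (k : ℝ) := by exact_mod_cast e
  rw [e']
  push_cast
  field_simp

/-! ### Each term of the Tóth sum through the column function -/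

/-- **`W_R(ξ) ψ_R(ξ) = [ad ∣ A'] e(hβ/α) colFn(α, γ)`** for `ξ` with first column `(α, γ)`, `α ≠ 0`
(`x > 0`, `Y₁ ≥ 1`, `L = log κ₁⁻¹`). [cite: Ngo2024, §3.2 Lemma 3.2, §3.5 Lemma 3.15] -/
theorem weylWeightSL_mul_tothWeight_eq (R : BinQF) {a : ℤ} (ha : 0 < a) (b : ℤ) (d : ℕ)
    {x Y₁ : ℝ} (hx : 0 < x) (hY : 1 ≤ Y₁) (h : ℤ) (g₁ : SL(2, ℤ)) (m : ℤ) (ξ : SL(2, ℤ))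
    (hα : ξ 0 0 ≠ 0) :
    weylWeightSL a b d ⌈3 * x⌉₊ h (fun n => (tothPlateau x Y₁ n : ℂ)) R ξ * (tothWeight R g₁ m ξ : ℂ) =
      (if ((a.toNat * d : ℕ) : ℤ) ∣ (smul R ξ).a then 1 else 0) * ex (h * (ξ 0 1 : ℝ) / (ξ 0 0)) *
        colFn R a b x Y₁ h (Real.log (deckFactor R g₁)⁻¹) m (ξ 0 0) (ξ 1 0) := by
  have hY0 : 0 < Y₁ := by linarith
  have ha0 : (0 : ℝ) < a := by exact_mod_cast ha
  have hcolA : colA R (ξ 0 0) (ξ 1 0) = ((smul R ξ).a : ℝ) := colA_col R ξ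
  rw [weylWeightSL, weylWeight]
  by_cases hdiv : ((a.toNat * d : ℕ) : ℤ) ∣ (smul R ξ).a
  · rw [if_pos hdiv, one_mul]
    by_cases hr : 0 < (smul R ξ).a ∧ (smul R ξ).a ≤ a * (⌈3 * x⌉₊ : ℕ)
    · rw [if_pos ⟨hdiv, hr⟩]
      have hA' : (smul R ξ).a ≠ 0 := hr.1.ne'
      have hA'r : ((smul R ξ).a : ℝ) ≠ 0 := by exact_mod_cast hA'
      have hadvd : a ∣ (smul R ξ).a := by
        have : (a : ℤ) ∣ ((a.toNat * d : ℕ) : ℤ) :=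
          ⟨d, by push_cast; rw [Int.toNat_of_nonneg ha.le]⟩
        exact this.trans hdiv
      have hidx : ((index a (smul R ξ) : ℕ) : ℝ) = ((smul R ξ).a : ℝ) / a :=
        index_cast_eq ha hadvd hr.1
      rw [colFn, if_neg (by rw [hcolA]; exact hA'r), hcolA, hidx,
        weylPhase_factor R ξ h b hα hA', colPsi_col]
      have e : ex ((h : ℝ) * colPhi R b (ξ 0 0) (ξ 1 0)) =
          ex (h * (((R.b : ℝ) * ξ 0 0 + 2 * R.c * ξ 1 0) / (2 * (ξ 0 0 : ℝ) * (smul R ξ).a)) -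
            h * (b : ℝ) / (2 * (smul R ξ).a)) := by
        rw [colPhi_col]; congr 1; ring
      rw [e]
      ring
    · rw [if_neg (fun h' => hr h'.2), zero_mul]
      symm
      suffices h0 : colFn R a b x Y₁ h (Real.log (deckFactor R g₁)⁻¹) m (ξ 0 0) (ξ 1 0) = 0 by
        rw [h0, mul_zero]
      rw [colFn]
      split_ifs with h0
      · rfl
      have hA' : (smul R ξ).a ≠ 0 := by
        intro h1; apply h0; rw [hcolA, h1]; simp
      have hplat : tothPlateau x Y₁ (colA R (ξ 0 0) (ξ 1 0) / a) = 0 := by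
        rw [hcolA]
        rcases lt_or_gt_of_ne hA' with hneg | hpos
        · apply tothPlateau_eq_zero_of_le hx hY0
          have h1 : ((smul R ξ).a : ℝ) / a < 0 := div_neg_of_neg_of_pos (by exact_mod_cast hneg) ha0
          have h2 : 0 ≤ x - x / Y₁ := by rw [sub_nonneg]; exact div_le_self hx.le hY
          linarith
        · have hgt : a * (⌈3 * x⌉₊ : ℕ) < (smul R ξ).a := by
            by_contra hle; exact hr ⟨hpos, not_lt.1 hle⟩
          apply tothPlateau_eq_zero_of_ge hx hY0
          have h1 : (a : ℝ) * ((⌈3 * x⌉₊ : ℕ) : ℝ) < (smul R ξ).a := by exact_mod_cast hgt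
          have h2 : 3 * x ≤ ((⌈3 * x⌉₊ : ℕ) : ℝ) := Nat.le_ceil _
          have h3 : x / Y₁ ≤ x := div_le_self hx.le hY
          rw [le_div_iff₀ ha0]
          nlinarith
      rw [hplat]
      simp
  · rw [if_neg hdiv, if_neg (fun h' => hdiv h'.1)]
    simp

/-! ### The arithmetic coefficient of a column -/

/-- The arithmetic coefficient of the column `α`:
`colCoef a d R h α γ = [(α,γ) = 1] [a ∣ γ] [ad ∣ A'(α,γ)] e(−h·gcdB(α,γ)/α)` (for coprime `(α, γ)`,
`γ·gcdB(α,γ) ≡ 1 (mod α)`, so the phase is the Kloosterman phase `e(−hγ̄/α)`).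
[cite: Ngo2024, §3.5 Lemma 3.15 (the arithmetic factor)] -/
def colCoef (a : ℤ) (d : ℕ) (R : BinQF) (h : ℤ) (α γ : ℤ) : ℂ :=
  if Int.gcd α γ = 1 ∧ a ∣ γ ∧ ((a.toNat * d : ℕ) : ℤ) ∣ R.eval α γ then
    ex (h * ((-Int.gcdB α γ : ℤ) : ℝ) / α) else 0

/-- `‖colCoef‖ ≤ 1`. [folklore] -/
theorem norm_colCoef_le_one (a : ℤ) (d : ℕ) (R : BinQF) (h α γ : ℤ) : ‖colCoef a d R h α γ‖ ≤ 1 := by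
  unfold colCoef; split_ifs
  · rw [norm_ex]
  · simp

/-- **The term of the Tóth sum at a primitive vector is `colCoef · colFn`** (`α ≠ 0`).
[cite: Ngo2024, §3.5 Lemma 3.15] -/
theorem tothTerm_eq_colCoef_mul_colFn (R : BinQF) {a : ℤ} (ha : 0 < a) (b : ℤ) (d : ℕ)
    {x Y₁ : ℝ} (hx : 0 < x) (hY : 1 ≤ Y₁) (h : ℤ) (g₁ : SL(2, ℤ)) (m : ℤ) (v : PrimVec a.toNat)
    (hα : v.1.1 ≠ 0) :
    weylWeightSL a b d ⌈3 * x⌉₊ h (fun n => (tothPlateau x Y₁ n : ℂ)) R v.toSL *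
        (tothWeight R g₁ m v.toSL : ℂ) =
      colCoef a d R h v.1.1 v.1.2 * colFn R a b x Y₁ h (Real.log (deckFactor R g₁)⁻¹) m v.1.1 v.1.2 := by
  have h00 : v.toSL 0 0 = v.1.1 := PrimVec.toSL_apply_00 v
  have h10 : v.toSL 1 0 = v.1.2 := PrimVec.toSL_apply_10 v
  have h01 : v.toSL 0 1 = -Int.gcdB v.1.1 v.1.2 := by
    rw [PrimVec.toSL, colMatrix_apply_01]
  rw [weylWeightSL_mul_tothWeight_eq R ha b d hx hY h g₁ m v.toSL (by rw [h00]; exact hα), smul_a, h01,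
    h00, h10, colCoef]
  have hadvd : a ∣ v.1.2 := by
    obtain ⟨k, hk⟩ := v.2.2
    exact ⟨k, by rw [hk, Int.toNat_of_nonneg ha.le]⟩
  by_cases hd : ((a.toNat * d : ℕ) : ℤ) ∣ R.eval v.1.1 v.1.2
  · rw [if_pos hd, if_pos ⟨v.2.1, hadvd, hd⟩, one_mul]
  · rw [if_neg hd, if_neg (fun h' => hd h'.2.2)]
    simp


/-! ### Periodicity of the arithmetic coefficient -/

/-- `gcd(α, γ + M) = gcd(α, γ)` for `α ∣ M`. [folklore] -/
theorem gcd_add_of_dvd {α γ M : ℤ} (h : α ∣ M) : Int.gcd α (γ + M) = Int.gcd α γ := by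
  obtain ⟨t, rfl⟩ := h
  rw [Int.gcd_comm, ← Int.gcd_emod, Int.add_mul_emod_self_left, Int.gcd_emod, Int.gcd_comm]

/-- `A'(α, γ + M) = A'(α, γ) + M·(Bα + C(2γ + M))`. [folklore] -/
theorem eval_add_right (R : BinQF) (α γ M : ℤ) :
    R.eval α (γ + M) = R.eval α γ + M * (R.b * α + R.c * (2 * γ + M)) := by
  simp only [BinQF.eval]; ring

/-- The Bezout coefficients of `(α, γ)` and `(α, γ + M)` agree mod `α` (coprime case, `α ∣ M`):
both invert `γ` modulo `α`. [folklore] -/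
theorem gcdB_add_modEq {α γ M : ℤ} (hg : Int.gcd α γ = 1) (hM : α ∣ M) :
    -Int.gcdB α (γ + M) ≡ -Int.gcdB α γ [ZMOD α] := by
  have hg' : Int.gcd α (γ + M) = 1 := by rw [gcd_add_of_dvd hM, hg]
  have h1 := col_mul_gcdB_modEq α γ hg            -- γ·B ≡ 1
  have h2 := col_mul_gcdB_modEq α (γ + M) hg'     -- (γ+M)·B' ≡ 1
  have h3 : (γ + M) * Int.gcdB α (γ + M) ≡ γ * Int.gcdB α (γ + M) [ZMOD α] := by
    obtain ⟨t, rfl⟩ := hM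
    rw [Int.modEq_iff_dvd]
    exact ⟨-(t * Int.gcdB α (γ + α * t)), by ring⟩
  have h4 : γ * Int.gcdB α (γ + M) ≡ γ * Int.gcdB α γ [ZMOD α] := (h3.symm.trans h2).trans h1.symm
  have hcop : IsCoprime α γ := Int.isCoprime_iff_gcd_eq_one.2 hg
  have h5 : α ∣ γ * (Int.gcdB α γ - Int.gcdB α (γ + M)) := by
    have := (Int.modEq_iff_dvd.1 h4)
    -- α ∣ γB − γB'
    have e : γ * Int.gcdB α γ - γ * Int.gcdB α (γ + M) = γ * (Int.gcdB α γ - Int.gcdB α (γ + M)) := by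
      ring
    rwa [e] at this
  have h6 : α ∣ Int.gcdB α γ - Int.gcdB α (γ + M) := hcop.dvd_of_dvd_mul_left h5
  rw [Int.modEq_iff_dvd]
  have e : -Int.gcdB α γ - -Int.gcdB α (γ + M) = -(Int.gcdB α γ - Int.gcdB α (γ + M)) := by ring
  rw [e]
  exact (dvd_neg).2 h6

/-- **Periodicity**: `colCoef(α, γ + M) = colCoef(α, γ)` whenever `α ∣ M`, `a ∣ M`, `ad ∣ M`
(`α ≠ 0`); in particular for `M = |α|·a·d` and its multiples. [cite: Ngo2024, §3.5 Lemma 3.15] -/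
theorem colCoef_add_period {a : ℤ} {d : ℕ} (R : BinQF) (h : ℤ) {α : ℤ} (hα : α ≠ 0) {γ M : ℤ}
    (hαM : α ∣ M) (haM : a ∣ M) (hadM : ((a.toNat * d : ℕ) : ℤ) ∣ M) :
    colCoef a d R h α (γ + M) = colCoef a d R h α γ := by
  unfold colCoef
  have e1 : Int.gcd α (γ + M) = Int.gcd α γ := gcd_add_of_dvd hαM
  have e2 : (a ∣ γ + M) ↔ (a ∣ γ) := dvd_add_left haM
  have e3 : (((a.toNat * d : ℕ) : ℤ) ∣ R.eval α (γ + M)) ↔ (((a.toNat * d : ℕ) : ℤ) ∣ R.eval α γ) := by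
    rw [eval_add_right]
    exact dvd_add_left (dvd_mul_of_dvd_left hadM _)
  simp only [e1, e2, e3]
  split_ifs with hc
  · exact ex_div_congr hα h (gcdB_add_modEq hc.1 hαM)
  · rfl

/-- The natural period `M_α = |α|·a·d` has the three divisibilities. [folklore] -/
theorem period_dvd {a : ℤ} (ha : 0 < a) (d : ℕ) (α : ℤ) :
    α ∣ ((α.natAbs * (a.toNat * d) : ℕ) : ℤ) ∧ a ∣ ((α.natAbs * (a.toNat * d) : ℕ) : ℤ) ∧
      ((a.toNat * d : ℕ) : ℤ) ∣ ((α.natAbs * (a.toNat * d) : ℕ) : ℤ) := by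
  have hαabs : α ∣ (α.natAbs : ℤ) := Int.dvd_natAbs.2 dvd_rfl
  have haa : a ∣ ((a.toNat : ℕ) : ℤ) := by rw [Int.toNat_of_nonneg ha.le]
  refine ⟨?_, ?_, ?_⟩
  · rw [Nat.cast_mul]; exact hαabs.mul_right _
  · rw [Nat.cast_mul, Nat.cast_mul]; exact (haa.mul_right _).mul_left _
  · exact Int.natCast_dvd_natCast.2 (dvd_mul_left _ _)

/-! ### The Tóth sum as a finite double sum -/

section doubleSum

variable {a : ℤ}

/-- The term of the Tóth sum, extended by zero to all of `ℤ × ℤ`. [folklore] -/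
def tothTermZ (R : BinQF) (a b : ℤ) (d : ℕ) (x Y₁ : ℝ) (h : ℤ) (g₁ : SL(2, ℤ)) (m : ℤ)
    (w : ℤ × ℤ) : ℂ :=
  if hw : Int.gcd w.1 w.2 = 1 ∧ ((a.toNat : ℕ) : ℤ) ∣ w.2 then
    weylWeightSL a b d ⌈3 * x⌉₊ h (fun n => (tothPlateau x Y₁ n : ℂ)) R
        (PrimVec.toSL (⟨w, hw⟩ : PrimVec a.toNat)) *
      (tothWeight R g₁ m (PrimVec.toSL (⟨w, hw⟩ : PrimVec a.toNat)) : ℂ)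
  else 0

/-- At a primitive vector the extended term is the term. [folklore] -/
theorem tothTermZ_val (R : BinQF) (a b : ℤ) (d : ℕ) (x Y₁ : ℝ) (h : ℤ) (g₁ : SL(2, ℤ)) (m : ℤ)
    (v : PrimVec a.toNat) :
    tothTermZ R a b d x Y₁ h g₁ m v.1 =
      weylWeightSL a b d ⌈3 * x⌉₊ h (fun n => (tothPlateau x Y₁ n : ℂ)) R v.toSL *
        (tothWeight R g₁ m v.toSL : ℂ) := by
  obtain ⟨w, hw⟩ := v
  show tothTermZ R a b d x Y₁ h g₁ m w = _
  unfold tothTermZ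
  rw [dif_pos hw]

/-- **The Tóth sum is the sum of the extended term over `ℤ × ℤ`.** [folklore] -/
theorem tothSum_eq_tsum_tothTermZ (R : BinQF) (a b : ℤ) (d : ℕ) (x Y₁ : ℝ) (h : ℤ)
    (g₁ : SL(2, ℤ)) (m : ℤ) :
    ∑' v : PrimVec a.toNat, weylWeightSL a b d ⌈3 * x⌉₊ h (fun n => (tothPlateau x Y₁ n : ℂ)) R
        v.toSL * (tothWeight R g₁ m v.toSL : ℂ) =
      ∑' w : ℤ × ℤ, tothTermZ R a b d x Y₁ h g₁ m w := by
  have e1 : (∑' v : PrimVec a.toNat, weylWeightSL a b d ⌈3 * x⌉₊ h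
      (fun n => (tothPlateau x Y₁ n : ℂ)) R v.toSL * (tothWeight R g₁ m v.toSL : ℂ)) =
      ∑' v : PrimVec a.toNat, tothTermZ R a b d x Y₁ h g₁ m v.1 :=
    tsum_congr fun v => (tothTermZ_val R a b d x Y₁ h g₁ m v).symm
  rw [e1]
  have e2 := tsum_subtype {w : ℤ × ℤ | Int.gcd w.1 w.2 = 1 ∧ ((a.toNat : ℕ) : ℤ) ∣ w.2}
    (tothTermZ R a b d x Y₁ h g₁ m)
  have e3 : {w : ℤ × ℤ | Int.gcd w.1 w.2 = 1 ∧ ((a.toNat : ℕ) : ℤ) ∣ w.2}.indicator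
      (tothTermZ R a b d x Y₁ h g₁ m) = tothTermZ R a b d x Y₁ h g₁ m := by
    funext w
    by_cases hw : w ∈ {w : ℤ × ℤ | Int.gcd w.1 w.2 = 1 ∧ ((a.toNat : ℕ) : ℤ) ∣ w.2}
    · rw [Set.indicator_of_mem hw]
    · have hw' : ¬ (Int.gcd w.1 w.2 = 1 ∧ ((a.toNat : ℕ) : ℤ) ∣ w.2) := hw
      rw [Set.indicator_of_notMem hw, tothTermZ, dif_neg hw']
  rw [e3] at e2
  exact e2

/-- Off the column `α = 0` the extended term is `colCoef · colFn`. [cite: Ngo2024, §3.5 Lemma 3.15] -/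
theorem tothTermZ_eq_colCoef_mul_colFn (R : BinQF) (ha : 0 < a) (b : ℤ) (d : ℕ) {x Y₁ : ℝ}
    (hx : 0 < x) (hY : 1 ≤ Y₁) (h : ℤ) (g₁ : SL(2, ℤ)) (m : ℤ) {w : ℤ × ℤ} (hα : w.1 ≠ 0) :
    tothTermZ R a b d x Y₁ h g₁ m w =
      colCoef a d R h w.1 w.2 * colFn R a b x Y₁ h (Real.log (deckFactor R g₁)⁻¹) m w.1 w.2 := by
  by_cases hw : Int.gcd w.1 w.2 = 1 ∧ ((a.toNat : ℕ) : ℤ) ∣ w.2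
  · have := tothTerm_eq_colCoef_mul_colFn R ha b d hx hY h g₁ m ⟨w, hw⟩ hα
    rw [← tothTermZ_val] at this
    exact this
  · rw [tothTermZ, dif_neg hw, colCoef, if_neg]
    · simp
    · rintro ⟨h1, h2, -⟩
      exact hw ⟨h1, by rwa [Int.toNat_of_nonneg ha.le]⟩

/-- On the column `α = 0` only `γ = ±1` can contribute. [folklore] -/
theorem tothTermZ_col_zero_eq_zero (R : BinQF) (a b : ℤ) (d : ℕ) (x Y₁ : ℝ) (h : ℤ)
    (g₁ : SL(2, ℤ)) (m : ℤ) {γ : ℤ} (hγ : γ ≠ 1 ∧ γ ≠ -1) :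
    tothTermZ R a b d x Y₁ h g₁ m (0, γ) = 0 := by
  rw [tothTermZ, dif_neg]
  rintro ⟨h1, -⟩
  rw [Int.gcd_zero_left] at h1
  rcases Int.natAbs_eq γ with h2 | h2 <;> rw [h1] at h2 <;> simp_all

/-- **Support of the extended term**: if the integer support of the column functions lies in
`|α|, |γ| ≤ B`, every `w` with `tothTermZ w ≠ 0` has `|w.1|, |w.2| ≤ max 1 B` (the column
`α = 0` contributes at most `γ = ±1`). [folklore] -/
theorem tothTermZ_support (ha : 0 < a) (b : ℤ) (d : ℕ) {x Y₁ : ℝ} (hx : 0 < x) (hY : 1 ≤ Y₁)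
    (h : ℤ) (g₁ : SL(2, ℤ)) (m : ℤ) {B : ℝ}
    (hsuppZ : ∀ α γ : ℤ, colFn R a b x Y₁ h (Real.log (deckFactor R g₁)⁻¹) m α γ ≠ 0 →
      |(α : ℝ)| ≤ B ∧ |(γ : ℝ)| ≤ B)
    {w : ℤ × ℤ} (hw : tothTermZ R a b d x Y₁ h g₁ m w ≠ 0) :
    |(w.1 : ℝ)| ≤ max 1 B ∧ |(w.2 : ℝ)| ≤ max 1 B := by
  by_cases hα : w.1 = 0
  · have h1 : ¬ (w.2 ≠ 1 ∧ w.2 ≠ -1) := by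
      intro hγ; apply hw
      have : w = (0, w.2) := Prod.ext hα rfl
      rw [this]; exact tothTermZ_col_zero_eq_zero R a b d x Y₁ h g₁ m hγ
    push Not at h1
    constructor
    · rw [hα]; simp
    · have : |(w.2 : ℝ)| = 1 := by
        by_cases h2 : w.2 = 1
        · rw [h2]; simp
        · rw [h1 h2]; simp
      rw [this]; exact le_max_left _ _
  · rw [tothTermZ_eq_colCoef_mul_colFn R ha b d hx hY h g₁ m hα] at hw
    have hF : colFn R a b x Y₁ h (Real.log (deckFactor R g₁)⁻¹) m w.1 w.2 ≠ 0 := by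
      intro h0; apply hw; rw [h0, mul_zero]
    obtain ⟨h1, h2⟩ := hsuppZ w.1 w.2 hF
    exact ⟨h1.trans (le_max_right _ _), h2.trans (le_max_right _ _)⟩

/-- The integer support bound from the support constants of `exists_colFn_support_consts`
(`Y₁ ≥ 2`): `B = c₂√x`. [folklore] -/
theorem colFn_intSupport_of_consts {x Y₁ : ℝ} (hx : 0 < x) (hY : 2 ≤ Y₁) (b h : ℤ) {L : ℝ} (m : ℤ)
    {c₁ c₂ : ℝ}
    (hc : ∀ (b : ℤ) (x Y₁ : ℝ) (h : ℤ) (u t : ℝ), 0 < x → 2 ≤ Y₁ →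
      colFn R a b x Y₁ h L m u t ≠ 0 →
        (c₁ * Real.sqrt x ≤ |u - t * rootPlus R| ∧ |u - t * rootPlus R| ≤ c₂ * Real.sqrt x) ∧
        (c₁ * Real.sqrt x ≤ |u - t * rootMinus R| ∧ |u - t * rootMinus R| ≤ c₂ * Real.sqrt x) ∧
        |t| ≤ c₂ * Real.sqrt x ∧ |u| ≤ c₂ * Real.sqrt x) :
    ∀ α γ : ℤ, colFn R a b x Y₁ h L m α γ ≠ 0 →
      |(α : ℝ)| ≤ c₂ * Real.sqrt x ∧ |(γ : ℝ)| ≤ c₂ * Real.sqrt x := by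
  intro α γ hF
  obtain ⟨-, -, h2, h1⟩ := hc b x Y₁ h α γ hx hY hF
  exact ⟨h1, h2⟩

end doubleSum


/-! ### The finite box and the split off the column `α = 0` -/

section box

variable {a : ℤ}

/-- The box `[-A, A]²`. [folklore] -/
def box (A : ℤ) : Finset (ℤ × ℤ) := Finset.Icc (-A) A ×ˢ Finset.Icc (-A) A

/-- `|w| ≤ A` in `ℝ` for an integer means membership in `[-A, A]`. [folklore] -/
theorem mem_Icc_of_abs_le {z A : ℤ} (h : |(z : ℝ)| ≤ A) : z ∈ Finset.Icc (-A) A := by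
  rw [Finset.mem_Icc]
  have h' : |z| ≤ A := by exact_mod_cast h
  exact abs_le.1 h'

/-- **The Tóth sum as a finite double sum over a box** containing the integer support
(`max(1, B) ≤ A`), split into the column `α = 0` and the columns `α ≠ 0`, the latter through
`colCoef · colFn`. [cite: Ngo2024, §3.5 Lemma 3.15] -/
theorem tothSum_eq_boxSum (ha : 0 < a) (b : ℤ) (d : ℕ) {x Y₁ : ℝ} (hx : 0 < x) (hY : 1 ≤ Y₁)
    (h : ℤ) (g₁ : SL(2, ℤ)) (m : ℤ) {B : ℝ}
    (hsuppZ : ∀ α γ : ℤ, colFn R a b x Y₁ h (Real.log (deckFactor R g₁)⁻¹) m α γ ≠ 0 →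
      |(α : ℝ)| ≤ B ∧ |(γ : ℝ)| ≤ B)
    {A : ℤ} (hAc : max 1 B ≤ (A : ℝ)) :
    ∑' v : PrimVec a.toNat, weylWeightSL a b d ⌈3 * x⌉₊ h (fun n => (tothPlateau x Y₁ n : ℂ)) R
        v.toSL * (tothWeight R g₁ m v.toSL : ℂ) =
      ∑ γ ∈ Finset.Icc (-A) A, tothTermZ R a b d x Y₁ h g₁ m (0, γ) +
        ∑ α ∈ (Finset.Icc (-A) A).erase 0, ∑ γ ∈ Finset.Icc (-A) A,
          colCoef a d R h α γ * colFn R a b x Y₁ h (Real.log (deckFactor R g₁)⁻¹) m α γ := by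
  have hA0 : (0 : ℤ) ≤ A := by
    have : (1 : ℝ) ≤ A := (le_max_left _ _).trans hAc
    exact_mod_cast (zero_le_one.trans this)
  rw [tothSum_eq_tsum_tothTermZ]
  -- the support lies in the box
  have hsupp : ∀ w ∉ box A, tothTermZ R a b d x Y₁ h g₁ m w = 0 := by
    intro w hw
    by_contra hne
    obtain ⟨h1, h2⟩ := tothTermZ_support ha b d hx hY h g₁ m hsuppZ hne
    exact hw (Finset.mem_product.2 ⟨mem_Icc_of_abs_le (h1.trans hAc), mem_Icc_of_abs_le (h2.trans hAc)⟩)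
  rw [tsum_eq_sum hsupp, box, Finset.sum_product,
    ← Finset.add_sum_erase _ _ (Finset.mem_Icc.2 ⟨by linarith, hA0⟩)]
  congr 1
  refine Finset.sum_congr rfl fun α hα => Finset.sum_congr rfl fun γ _ => ?_
  exact tothTermZ_eq_colCoef_mul_colFn R ha b d hx hY h g₁ m (Finset.ne_of_mem_erase hα)

/-- For Tóth's shift `m = tothShift R g₁` the column `α = 0` does not contribute. [folklore] -/
theorem boxSum_col_zero_eq_zero (R : BinQF) (a b : ℤ) (d : ℕ) (x Y₁ : ℝ) (h : ℤ) (g₁ : SL(2, ℤ))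
    (A : ℤ) :
    ∑ γ ∈ Finset.Icc (-A) A, tothTermZ R a b d x Y₁ h g₁ (tothShift R g₁) (0, γ) = 0 := by
  refine Finset.sum_eq_zero fun γ _ => ?_
  unfold tothTermZ
  split_ifs with hw
  · rw [tothWeight_eq_zero_of_col R g₁ (by rfl)]
    simp
  · rfl

end box

/-! ### Poisson summation in each column -/

section poisson

open Real
open scoped FourierTransform

variable {a : ℤ}

/-- Periodicity under all multiples of the period. [folklore] -/
theorem colCoef_add_mul_period (ha : 0 < a) (d : ℕ) (R : BinQF) (h : ℤ) {α : ℤ} (hα : α ≠ 0)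
    (γ q : ℤ) :
    colCoef a d R h α (γ + ((α.natAbs * (a.toNat * d) : ℕ) : ℤ) * q) = colCoef a d R h α γ := by
  obtain ⟨h1, h2, h3⟩ := period_dvd ha d α
  exact colCoef_add_period R h hα (h1.mul_right q) (h2.mul_right q) (h3.mul_right q)

/-- The column function of an integer column `α ≠ 0` is smooth (as needed for Poisson). [folklore] -/
theorem contDiff_colFn_col (hA : R.a ≠ 0) (hΔ : 0 < R.disc) (ha : 0 < a) (b : ℤ) {x Y₁ : ℝ}
    (hx : 0 < x) (hY : 2 ≤ Y₁) (h : ℤ) {L : ℝ} (hL : 0 < L) (m : ℤ) {α : ℤ} (hα : α ≠ 0) :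
    ContDiff ℝ ((⊤ : ℕ∞) : WithTop ℕ∞) (fun t => colFn R a b x Y₁ h L m α t) :=
  contDiff_colFn hA hΔ ha b hx hY h hL m (by exact_mod_cast hα)

/-- **Poisson summation in the column `α ≠ 0`**: with the period `M = |α|·a·d` and `A` so large
that the column's support lies in `[-A, A]`,
`∑_{|γ| ≤ A} colCoef(α,γ) colFn(α,γ) = ∑_{r mod M} colCoef(α,r) · M⁻¹ ∑_κ e(rκ/M) 𝓕(colFn(α,·))(κ/M)`.
[cite: Ngo2024, §3.5 Lemma 3.15] -/
theorem colSum_eq_poisson (hA : R.a ≠ 0) (hΔ : 0 < R.disc) (ha : 0 < a) (b : ℤ) {d : ℕ} (hd : 0 < d)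
    {x Y₁ : ℝ} (hx : 0 < x) (hY : 2 ≤ Y₁) (h : ℤ) {L : ℝ} (hL : 0 < L) (m : ℤ) {α : ℤ} (hα : α ≠ 0)
    {A : ℤ} (hsupp : ∀ γ : ℤ, colFn R a b x Y₁ h L m α γ ≠ 0 → |(γ : ℝ)| ≤ A) :
    ∑ γ ∈ Finset.Icc (-A) A, colCoef a d R h α γ * colFn R a b x Y₁ h L m α γ =
      ∑ r : Fin (α.natAbs * (a.toNat * d)), colCoef a d R h α r *
        ((((α.natAbs * (a.toNat * d) : ℕ) : ℂ))⁻¹ *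
          ∑' κ : ℤ, (𝐞 (((r : ℕ) : ℝ) * κ / ((α.natAbs * (a.toNat * d) : ℕ) : ℝ)) : ℂ) *
            𝓕 (fun t => colFn R a b x Y₁ h L m α t) ((κ : ℝ) / ((α.natAbs * (a.toNat * d) : ℕ) : ℝ))) := by
  -- the period
  set M : ℕ := α.natAbs * (a.toNat * d) with hMdef
  have ha' : 0 < a.toNat := by omega
  have hM0 : 0 < M := Nat.mul_pos (Int.natAbs_pos.2 hα) (Nat.mul_pos ha' hd)
  haveI : NeZero M := ⟨hM0.ne'⟩
  have hM1 : (1 : ℤ) ≤ M := by exact_mod_cast hM0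
  -- the column summand on `ℤ`
  set g : ℤ → ℂ := fun γ => colCoef a d R h α γ * colFn R a b x Y₁ h L m α γ with hg
  have hgsupp : ∀ γ : ℤ, γ ∉ Finset.Icc (-A) A → g γ = 0 := by
    intro γ hγ
    by_contra hne
    have hF : colFn R a b x Y₁ h L m α γ ≠ 0 := by
      intro h0; apply hne; simp only [hg, h0, mul_zero]
    exact hγ (mem_Icc_of_abs_le (hsupp γ hF))
  -- (a) the finite sum is the full sum over `ℤ`
  rw [show (∑ γ ∈ Finset.Icc (-A) A, colCoef a d R h α γ * colFn R a b x Y₁ h L m α γ) =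
    ∑' γ : ℤ, g γ from (tsum_eq_sum hgsupp).symm]
  -- (b) reindex by `γ = qM + r`
  rw [← (Int.divModEquiv M).symm.tsum_eq g]
  have hG : ∀ p : ℤ × Fin M, g ((Int.divModEquiv M).symm p) =
      colCoef a d R h α p.2 * colFn R a b x Y₁ h L m α ((p.2 : ℤ) + (M : ℤ) * p.1 : ℤ) := by
    intro p
    rw [Int.divModEquiv_symm_apply]
    simp only [hg]
    rw [show p.1 * (M : ℤ) + ((p.2 : ℕ) : ℤ) = ((p.2 : ℕ) : ℤ) + (M : ℤ) * p.1 by ring,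
      colCoef_add_mul_period ha d R h hα]
  simp_rw [hG]
  -- (c) the reindexed sum has finite support inside `[-A-1, A] × univ`
  have hGsupp : ∀ p : ℤ × Fin M, p ∉ (Finset.Icc (-A - 1) A ×ˢ (Finset.univ : Finset (Fin M))) →
      colCoef a d R h α p.2 * colFn R a b x Y₁ h L m α ((p.2 : ℤ) + (M : ℤ) * p.1 : ℤ) = 0 := by
    intro p hp
    by_contra hne
    have hF : colFn R a b x Y₁ h L m α (((p.2 : ℕ) : ℤ) + (M : ℤ) * p.1 : ℤ) ≠ 0 := by
      intro h0; apply hne; rw [h0, mul_zero]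
    have hb := hsupp _ hF
    have hb' : |((p.2 : ℕ) : ℤ) + (M : ℤ) * p.1| ≤ A := by exact_mod_cast hb
    have hr0 : (0 : ℤ) ≤ ((p.2 : ℕ) : ℤ) := by positivity
    have hrM : ((p.2 : ℕ) : ℤ) < M := by exact_mod_cast p.2.isLt
    obtain ⟨hlo, hhi⟩ := abs_le.1 hb'
    apply hp
    rw [Finset.mem_product, Finset.mem_Icc]
    refine ⟨⟨?_, ?_⟩, Finset.mem_univ _⟩
    · -- `-A - 1 ≤ q`: from `-A ≤ r + Mq`, `r < M`
      by_contra hlt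
      push Not at hlt
      have : (M : ℤ) * p.1 ≤ (M : ℤ) * (-A - 2) := by
        apply mul_le_mul_of_nonneg_left _ (by positivity); omega
      nlinarith
    · by_contra hlt
      push Not at hlt
      have : (M : ℤ) * (A + 1) ≤ (M : ℤ) * p.1 := by
        apply mul_le_mul_of_nonneg_left _ (by positivity); omega
      nlinarith
  rw [tsum_eq_sum hGsupp, Finset.sum_product_right]
  refine Finset.sum_congr rfl fun r _ => ?_
  dsimp only
  rw [← Finset.mul_sum]
  congr 1
  -- (d) back to a full sum over `q ∈ ℤ` and Poisson
  have hqsupp : ∀ q : ℤ, q ∉ Finset.Icc (-A - 1) A →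
      colFn R a b x Y₁ h L m α (((r : ℕ) : ℤ) + (M : ℤ) * q : ℤ) = 0 := by
    intro q hq
    have := hGsupp (q, r) (by
      rw [Finset.mem_product, not_and_or]; exact Or.inl hq)
    by_contra hne
    have hF : colFn R a b x Y₁ h L m α (((r : ℕ) : ℤ) + (M : ℤ) * q : ℤ) ≠ 0 := hne
    have hb := hsupp _ hF
    have hb' : |((r : ℕ) : ℤ) + (M : ℤ) * q| ≤ A := by exact_mod_cast hb
    have hr0 : (0 : ℤ) ≤ ((r : ℕ) : ℤ) := by positivity
    have hrM : ((r : ℕ) : ℤ) < M := by exact_mod_cast r.isLt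
    obtain ⟨hlo, hhi⟩ := abs_le.1 hb'
    apply hq
    rw [Finset.mem_Icc]
    constructor
    · by_contra hlt
      push Not at hlt
      have : (M : ℤ) * q ≤ (M : ℤ) * (-A - 2) := by
        apply mul_le_mul_of_nonneg_left _ (by positivity); omega
      nlinarith
    · by_contra hlt
      push Not at hlt
      have : (M : ℤ) * (A + 1) ≤ (M : ℤ) * q := by
        apply mul_le_mul_of_nonneg_left _ (by positivity); omega
      nlinarith
  have e : (∑' q : ℤ, colFn R a b x Y₁ h L m α (((r : ℕ) : ℤ) + (M : ℤ) * q : ℤ)) =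
      ∑ q ∈ Finset.Icc (-A - 1) A, colFn R a b x Y₁ h L m α (((r : ℕ) : ℤ) + (M : ℤ) * q : ℤ) :=
    tsum_eq_sum hqsupp
  rw [← e]
  have hP := FriedlanderIwaniecPrimes.tsum_arithProg_eq_tsum_fourier
    (F := fun t => colFn R a b x Y₁ h L m α t) (contDiff_colFn_col hA hΔ ha b hx hY h hL m hα)
    (hasCompactSupport_colFn hA hΔ ha b hx hY h hL m α) hM0 ((r : ℕ) : ℤ)
  push_cast at hP ⊢
  exact hP

end poisson


/-! ### The dual form: complete exponential sums times Fourier transforms -/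

section dual

open Real
open scoped FourierTransform

variable {a : ℤ}

/-- **The complete exponential sum of the column `α`** (period `M = |α|·a·d`):
`S_α(h, κ) = ∑_{r mod M} colCoef(α, r) e(rκ/M)
           = ∑_{r mod M, (α,r)=1, a∣r, ad ∣ A'(α,r)} e(−h r̄/α + rκ/M)` — a Kloosterman-type sum to
modulus `α` twisted by the level-`ad` root condition (for `κ = 0` a Ramanujan-type sum).
[cite: Ngo2024, §3.5 Lemma 3.15 (the sums `S_{σ∞σ𝔞}(h, κ; c√N'')`), §2.1 Definition 2.1] -/
def colExpSum (a : ℤ) (d : ℕ) (R : BinQF) (h α κ : ℤ) : ℂ :=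
  ∑ r : Fin (α.natAbs * (a.toNat * d)), colCoef a d R h α r *
    (𝐞 (((r : ℕ) : ℝ) * κ / ((α.natAbs * (a.toNat * d) : ℕ) : ℝ)) : ℂ)

/-- The trivial bound `‖S_α(h, κ)‖ ≤ M`. [folklore] -/
theorem norm_colExpSum_le (a : ℤ) (d : ℕ) (R : BinQF) (h α κ : ℤ) :
    ‖colExpSum a d R h α κ‖ ≤ (α.natAbs * (a.toNat * d) : ℕ) := by
  unfold colExpSum
  refine (norm_sum_le _ _).trans ?_
  calc ∑ r : Fin (α.natAbs * (a.toNat * d)), ‖colCoef a d R h α r *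
        (𝐞 (((r : ℕ) : ℝ) * κ / ((α.natAbs * (a.toNat * d) : ℕ) : ℝ)) : ℂ)‖
      ≤ ∑ _r : Fin (α.natAbs * (a.toNat * d)), (1 : ℝ) := by
        refine Finset.sum_le_sum fun r _ => ?_
        rw [norm_mul, Circle.norm_coe, mul_one]
        exact norm_colCoef_le_one _ _ _ _ _ _
    _ = _ := by simp

/-- **The dual form of a column**: the `r`-sum of the Poisson identities is
`M⁻¹ ∑_κ 𝓕(colFn(α,·))(κ/M) · S_α(h, κ)` (absolute convergence from the decay of `𝓕`).
[cite: Ngo2024, §3.5 Lemma 3.15] -/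
theorem colSum_eq_dual (hA : R.a ≠ 0) (hΔ : 0 < R.disc) (ha : 0 < a) (b : ℤ) {d : ℕ} (hd : 0 < d)
    {x Y₁ : ℝ} (hx : 0 < x) (hY : 2 ≤ Y₁) (h : ℤ) {L : ℝ} (hL : 0 < L) (m : ℤ) {α : ℤ} (hα : α ≠ 0)
    {A : ℤ} (hsupp : ∀ γ : ℤ, colFn R a b x Y₁ h L m α γ ≠ 0 → |(γ : ℝ)| ≤ A) :
    ∑ γ ∈ Finset.Icc (-A) A, colCoef a d R h α γ * colFn R a b x Y₁ h L m α γ =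
      (((α.natAbs * (a.toNat * d) : ℕ) : ℂ))⁻¹ *
        ∑' κ : ℤ, 𝓕 (fun t => colFn R a b x Y₁ h L m α t)
            ((κ : ℝ) / ((α.natAbs * (a.toNat * d) : ℕ) : ℝ)) * colExpSum a d R h α κ := by
  rw [colSum_eq_poisson hA hΔ ha b hd hx hY h hL m hα hsupp]
  set M : ℕ := α.natAbs * (a.toNat * d) with hMdef
  have ha' : 0 < a.toNat := by omega
  have hM0 : 0 < M := Nat.mul_pos (Int.natAbs_pos.2 hα) (Nat.mul_pos ha' hd)
  have hMr : (0 : ℝ) < M := by exact_mod_cast hM0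
  set F : ℝ → ℂ := fun t => colFn R a b x Y₁ h L m α t with hF
  -- absolute summability of the dual sum
  have hsum : Summable fun κ : ℤ => ‖𝓕 F ((κ : ℝ) / M)‖ :=
    summable_norm_iff.2 (FriedlanderIwaniecPrimes.summable_fourier_div
      (contDiff_colFn_col hA hΔ ha b hx hY h hL m hα) (hasCompactSupport_colFn hA hΔ ha b hx hY h hL m α) hMr)
  have hsr : ∀ r : Fin M, Summable fun κ : ℤ =>
      colCoef a d R h α r * ((M : ℂ)⁻¹ * ((𝐞 (((r : ℕ) : ℝ) * κ / M) : ℂ) * 𝓕 F ((κ : ℝ) / M))) := by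
    intro r
    refine Summable.of_norm_bounded (hsum.mul_left (‖colCoef a d R h α r‖ * ‖(M : ℂ)⁻¹‖)) ?_
    intro κ
    rw [norm_mul, norm_mul, norm_mul, Circle.norm_coe, one_mul, mul_assoc]
  -- swap the finite `r`-sum and the `κ`-sum
  calc ∑ r : Fin M, colCoef a d R h α r * ((M : ℂ)⁻¹ *
        ∑' κ : ℤ, (𝐞 (((r : ℕ) : ℝ) * κ / M) : ℂ) * 𝓕 F ((κ : ℝ) / M))
      = ∑ r : Fin M, ∑' κ : ℤ, colCoef a d R h α r * ((M : ℂ)⁻¹ *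
          ((𝐞 (((r : ℕ) : ℝ) * κ / M) : ℂ) * 𝓕 F ((κ : ℝ) / M))) := by
        refine Finset.sum_congr rfl fun r _ => ?_
        rw [← tsum_mul_left, ← tsum_mul_left]
    _ = ∑' κ : ℤ, ∑ r : Fin M, colCoef a d R h α r * ((M : ℂ)⁻¹ *
          ((𝐞 (((r : ℕ) : ℝ) * κ / M) : ℂ) * 𝓕 F ((κ : ℝ) / M))) :=
        (Summable.tsum_finsetSum (fun r _ => hsr r)).symm
    _ = ∑' κ : ℤ, (M : ℂ)⁻¹ * (𝓕 F ((κ : ℝ) / M) * colExpSum a d R h α κ) := by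
        refine tsum_congr fun κ => ?_
        rw [colExpSum, Finset.mul_sum, Finset.mul_sum]
        refine Finset.sum_congr rfl fun r _ => ?_
        ring
    _ = (M : ℂ)⁻¹ * ∑' κ : ℤ, 𝓕 F ((κ : ℝ) / M) * colExpSum a d R h α κ := tsum_mul_left

/-- **The Tóth sum in dual form** (Tóth's shift `m = tothShift R g₁`, so the column `α = 0` drops):
`T = ∑_{0 < |α| ≤ A} M_α⁻¹ ∑_κ 𝓕(colFn(α,·))(κ/M_α) S_α(h, κ)` for every `A ≥ max(1, B)`, `B` a
bound for the integer support of the column functions (e.g. `B = c₂√x`,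
`colFn_intSupport_of_consts`).  This is the Poisson-dual form of Ngo's Lemma 3.15 in the
first-column conventions of this tree; the remaining analytic input of `HP` is a bound for these
sums of Kloosterman-type sums weighted by the Fourier transforms (Ngo2024 Theorem 2.5, Pitt).
[cite: Ngo2024, §3.5 Lemma 3.15; Toth2000, §4] -/
theorem tothSum_eq_dualSum (hA : R.a ≠ 0) (hΔ : 0 < R.disc) (ha : 0 < a) (b : ℤ) {d : ℕ} (hd : 0 < d)
    {x Y₁ : ℝ} (hx : 0 < x) (hY : 2 ≤ Y₁) (h : ℤ) {g₁ : SL(2, ℤ)} (hκ0 : 0 < deckFactor R g₁)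
    (hκ1 : deckFactor R g₁ < 1) {B : ℝ}
    (hsuppZ : ∀ α γ : ℤ, colFn R a b x Y₁ h (Real.log (deckFactor R g₁)⁻¹) (tothShift R g₁) α γ ≠ 0 →
      |(α : ℝ)| ≤ B ∧ |(γ : ℝ)| ≤ B)
    {A : ℤ} (hAc : max 1 B ≤ (A : ℝ)) :
    ∑' v : PrimVec a.toNat, weylWeightSL a b d ⌈3 * x⌉₊ h (fun n => (tothPlateau x Y₁ n : ℂ)) R
        v.toSL * (tothWeight R g₁ (tothShift R g₁) v.toSL : ℂ) =
      ∑ α ∈ (Finset.Icc (-A) A).erase 0, (((α.natAbs * (a.toNat * d) : ℕ) : ℂ))⁻¹ *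
        ∑' κ : ℤ, 𝓕 (fun t => colFn R a b x Y₁ h (Real.log (deckFactor R g₁)⁻¹) (tothShift R g₁) α t)
            ((κ : ℝ) / ((α.natAbs * (a.toNat * d) : ℕ) : ℝ)) * colExpSum a d R h α κ := by
  have hL : 0 < Real.log (deckFactor R g₁)⁻¹ := Real.log_pos ((one_lt_inv₀ hκ0).2 hκ1)
  rw [tothSum_eq_boxSum ha b d hx (by linarith) h g₁ (tothShift R g₁) hsuppZ hAc,
    boxSum_col_zero_eq_zero, zero_add]
  refine Finset.sum_congr rfl fun α hα => ?_
  have hα0 : α ≠ 0 := Finset.ne_of_mem_erase hα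
  refine colSum_eq_dual hA hΔ ha b hd hx hY h hL _ hα0 fun γ hγ => ?_
  exact (hsuppZ α γ hγ).2.trans ((le_max_right _ _).trans hAc)

end dual


/-! ### From a bound for the dual sums to the Poincaré-series bound `HP` -/

section dualBound

open Real Polynomial
open scoped FourierTransform
open ModularGroup (T)

variable {a : ℤ}

/-- **The Tóth sum does not depend on the shift `m`** (both sides of the unfolding identity
`tsum_primVec_mul_tothWeight` equal `2 ∑_{T-classes} W_R`). [cite: Ngo2024, §3.4 Proposition 3.12] -/
theorem tothSum_indep_shift (hA : R.a ≠ 0) (hΔ : 0 < R.disc) (hsq : ¬ IsSquare R.disc) (b : ℤ)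
    (d N : ℕ) (h : ℤ) (G : ℕ → ℂ) {g₁ : SL(2, ℤ)} (hg₁ : g₁ ∈ stabLevel R a.toNat)
    (hκ : deckFactor R g₁ < 1) (hgen : ∀ g ∈ stabLevel R a.toNat, ∃ k : ℤ, g = g₁ ^ k ∨ g = -g₁ ^ k)
    (m m' : ℤ) :
    ∑' v : PrimVec a.toNat, weylWeightSL a b d N h G R v.toSL * (tothWeight R g₁ m v.toSL : ℂ) =
      ∑' v : PrimVec a.toNat, weylWeightSL a b d N h G R v.toSL * (tothWeight R g₁ m' v.toSL : ℂ) := by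
  have hWl : ∀ g ∈ stabLevel R a.toNat, ∀ ξ : SL(2, ℤ),
      weylWeightSL a b d N h G R (g * ξ) = weylWeightSL a b d N h G R ξ :=
    fun g hg ξ => weylWeightSL_stab_mul hg.1 ξ
  have hWr : ∀ (ξ : SL(2, ℤ)) (j : ℤ), weylWeightSL a b d N h G R (ξ * T ^ j) = weylWeightSL a b d N h G R ξ :=
    fun ξ j => weylWeightSL_mul_T_zpow R ξ j
  rw [tsum_primVec_mul_tothWeight hA hΔ hsq hg₁ hκ hgen m hWl hWr (finite_support_weylWeightSL R),
    tsum_primVec_mul_tothWeight hA hΔ hsq hg₁ hκ hgen m' hWl hWr (finite_support_weylWeightSL R)]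

/-- **The dual-sum bound `HD` implies the Poincaré-series bound `HP`** (for fixed `a, b, c`): if
the sums of Kloosterman-type sums `∑_{0<|α|≤A} M_α⁻¹ ∑_κ 𝓕(colFn(α,·))(κ/M_α) S_α(h,κ)` (the dual
form of the Tóth sums, `tothSum_eq_dualSum`, Tóth's shift) satisfy Ngo's Proposition-3.18 bound,
then so do the Tóth sums themselves, for every shift `m`. [cite: Ngo2024, §3.5 Lemma 3.15, Proposition 3.18] -/
theorem tothPoincareBound_of_dualBound {b c : ℤ} (ha : 0 < a) (hΔ : 0 < discrim a b c)
    (hsq : ¬ IsSquare (discrim a b c))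
    (HD : ∀ R : BinQF, IsLevelForm a b (discrim a b c) a.toNat R → R.a ≠ 0 →
      ∀ g₁ : SL(2, ℤ), g₁ ∈ stabLevel R a.toNat → deckFactor R g₁ < 1 →
        (∀ s ∈ stabLevel R a.toNat, ∃ k : ℤ, s = g₁ ^ k ∨ s = -g₁ ^ k) →
      ∀ ε : ℝ, 0 < ε → ∀ Ch : ℝ, 0 < Ch → ∃ K : ℝ, 0 ≤ K ∧
        ∀ x Y₁ : ℝ, 2 ≤ Y₁ → Y₁ ≤ x → ∀ d : ℕ, 1 ≤ d → (d : ℝ) ^ 2 ≤ x →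
          ∀ h : ℤ, h ≠ 0 → |(h : ℝ)| ≤ Ch * x →
          ∀ A : ℤ, (∀ α γ : ℤ, colFn R a b x Y₁ h (Real.log (deckFactor R g₁)⁻¹) (tothShift R g₁) α γ ≠ 0 →
              |(α : ℝ)| ≤ A ∧ |(γ : ℝ)| ≤ A) →
          ‖∑ α ∈ (Finset.Icc (-A) A).erase 0, (((α.natAbs * (a.toNat * d) : ℕ) : ℂ))⁻¹ *
              ∑' κ : ℤ, 𝓕 (fun t => colFn R a b x Y₁ h (Real.log (deckFactor R g₁)⁻¹) (tothShift R g₁) α t)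
                ((κ : ℝ) / ((α.natAbs * (a.toNat * d) : ℕ) : ℝ)) * colExpSum a d R h α κ‖ ≤
            K * ((Int.gcd h d : ℝ) ^ (1 / 4 : ℝ) * x ^ (3 / 4 : ℝ) * (d : ℝ) ^ (-(1 / 2) : ℝ) *
                  Y₁ ^ (9 / 4 : ℝ) + x ^ (1 / 2 : ℝ) * Y₁ ^ (3 : ℝ)) * (x * d * Y₁) ^ ε) :
    ∀ R : BinQF, IsLevelForm a b (discrim a b c) a.toNat R → R.a ≠ 0 →
      ∀ g₁ : SL(2, ℤ), g₁ ∈ stabLevel R a.toNat → deckFactor R g₁ < 1 →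
        (∀ s ∈ stabLevel R a.toNat, ∃ k : ℤ, s = g₁ ^ k ∨ s = -g₁ ^ k) →
      ∀ m : ℤ, ∀ ε : ℝ, 0 < ε → ∀ Ch : ℝ, 0 < Ch → ∃ K : ℝ, 0 ≤ K ∧
        ∀ x Y₁ : ℝ, 2 ≤ Y₁ → Y₁ ≤ x → ∀ d : ℕ, 1 ≤ d → (d : ℝ) ^ 2 ≤ x →
          ∀ h : ℤ, h ≠ 0 → |(h : ℝ)| ≤ Ch * x →
          ‖∑' v : PrimVec a.toNat,
              weylWeightSL a b d ⌈3 * x⌉₊ h (fun n => (tothPlateau x Y₁ n : ℂ)) R v.toSL *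
                (tothWeight R g₁ m v.toSL : ℂ)‖ ≤
            K * ((Int.gcd h d : ℝ) ^ (1 / 4 : ℝ) * x ^ (3 / 4 : ℝ) * (d : ℝ) ^ (-(1 / 2) : ℝ) *
                  Y₁ ^ (9 / 4 : ℝ) + x ^ (1 / 2 : ℝ) * Y₁ ^ (3 : ℝ)) * (x * d * Y₁) ^ ε := by
  intro R hR hRa g₁ hg₁ hκ hgen m ε hε Ch hCh
  obtain ⟨K, hK0, hK⟩ := HD R hR hRa g₁ hg₁ hκ hgen ε hε Ch hCh
  refine ⟨K, hK0, ?_⟩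
  intro x Y₁ hY hYx d hd hdx h hh hhx
  have hx : 0 < x := by linarith
  have hΔR : 0 < R.disc := by rw [hR.disc_eq]; exact hΔ
  have hsqR : ¬ IsSquare R.disc := by rw [hR.disc_eq]; exact hsq
  have hκ0 : 0 < deckFactor R g₁ := deckFactor_pos hRa hΔR.le hg₁.1
  have hL : 0 < Real.log (deckFactor R g₁)⁻¹ := Real.log_pos ((one_lt_inv₀ hκ0).2 hκ)
  -- pass to Tóth's shift and to the dual form
  rw [tothSum_indep_shift hRa hΔR hsqR b d _ h _ hg₁ hκ hgen m (tothShift R g₁)]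
  obtain ⟨c₁, c₂, -, -, hc⟩ := exists_colFn_support_consts hRa hΔR ha hL (tothShift R g₁)
  have hsuppZ := colFn_intSupport_of_consts (R := R) (a := a) hx hY b h (tothShift R g₁) hc
  set A : ℤ := ⌈max 1 (c₂ * Real.sqrt x)⌉ with hAdef
  have hAc : max 1 (c₂ * Real.sqrt x) ≤ (A : ℝ) := Int.le_ceil _
  rw [tothSum_eq_dualSum hRa hΔR ha b (by omega) hx hY h hκ0 hκ hsuppZ hAc]
  exact hK x Y₁ hY hYx d hd hdx h hh hhx A fun α γ hF =>
    ⟨(hsuppZ α γ hF).1.trans ((le_max_right _ _).trans hAc),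
      (hsuppZ α γ hF).2.trans ((le_max_right _ _).trans hAc)⟩

/-- **Tóth's theorem from the dual-sum bound.**  If for every `f = ax² + bx + c` with `a > 0` and
non-square `Δ > 0` the Poisson-dual sums `∑_{0<|α|≤A} M_α⁻¹ ∑_κ 𝓕(colFn(α,·))(κ/M_α) S_α(h,κ)`
(sums of Kloosterman-type sums to modulus `α` twisted by the level-`ad` root condition, weighted by
the Fourier transforms of the column functions) obey Ngo's Proposition-3.18 bound `HD`, then
`toth2000_quadraticRoots_primeModuli` holds.  On paper `HD` is Ngo2024 §3.5–3.6 (Fourier-integral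
bounds, dyadic partitions) + Theorem 2.5 (Pitt's bound for sums of Kloosterman sums on `Γ₀(q)`:
Kuznetsov's formula, the spectral large sieve, exceptional spectrum).  Everything else is proved
in the tree (`…TothReduction.toth2000_quadraticRoots_primeModuli_of_tothPoincareBound` and this
file). [cite: Toth2000, main theorem; Ngo2024, §3.5 Lemma 3.15, Proposition 3.18, §2.2 Theorem 2.5] -/
theorem toth2000_quadraticRoots_primeModuli_of_dualBound
    (HD : ∀ a b c : ℤ, 0 < a → 0 < discrim a b c → ¬ IsSquare (discrim a b c) →
      ∀ R : BinQF, IsLevelForm a b (discrim a b c) a.toNat R → R.a ≠ 0 →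
      ∀ g₁ : SL(2, ℤ), g₁ ∈ stabLevel R a.toNat → deckFactor R g₁ < 1 →
        (∀ s ∈ stabLevel R a.toNat, ∃ k : ℤ, s = g₁ ^ k ∨ s = -g₁ ^ k) →
      ∀ ε : ℝ, 0 < ε → ∀ Ch : ℝ, 0 < Ch → ∃ K : ℝ, 0 ≤ K ∧
        ∀ x Y₁ : ℝ, 2 ≤ Y₁ → Y₁ ≤ x → ∀ d : ℕ, 1 ≤ d → (d : ℝ) ^ 2 ≤ x →
          ∀ h : ℤ, h ≠ 0 → |(h : ℝ)| ≤ Ch * x →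
          ∀ A : ℤ, (∀ α γ : ℤ, colFn R a b x Y₁ h (Real.log (deckFactor R g₁)⁻¹) (tothShift R g₁) α γ ≠ 0 →
              |(α : ℝ)| ≤ A ∧ |(γ : ℝ)| ≤ A) →
          ‖∑ α ∈ (Finset.Icc (-A) A).erase 0, (((α.natAbs * (a.toNat * d) : ℕ) : ℂ))⁻¹ *
              ∑' κ : ℤ, 𝓕 (fun t => colFn R a b x Y₁ h (Real.log (deckFactor R g₁)⁻¹) (tothShift R g₁) α t)
                ((κ : ℝ) / ((α.natAbs * (a.toNat * d) : ℕ) : ℝ)) * colExpSum a d R h α κ‖ ≤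
            K * ((Int.gcd h d : ℝ) ^ (1 / 4 : ℝ) * x ^ (3 / 4 : ℝ) * (d : ℝ) ^ (-(1 / 2) : ℝ) *
                  Y₁ ^ (9 / 4 : ℝ) + x ^ (1 / 2 : ℝ) * Y₁ ^ (3 : ℝ)) * (x * d * Y₁) ^ ε) :
    toth2000_quadraticRoots_primeModuli :=
  toth2000_quadraticRoots_primeModuli_of_tothPoincareBound fun a b c ha hΔ hsq =>
    tothPoincareBound_of_dualBound ha hΔ hsq (HD a b c ha hΔ hsq)

end dualBound

end RootForms

end Literature.NumberTheory.Sieve
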